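/- Copyright: the pub-balaban-gaps cell (G2 seat ne6, gen 9; row NE7b), for the b2b-balaban T⁴-continuum CRUX team's row-NE7b OWNER
lineage `t4-ne7b-p1` (INTERFACE REQUEST NE7b IR-104-2, ruling W-ne7bp1-g104-4) and its refuter desk (τ-ne7bref-g63-1 ∕ π-ne7bref-g63-4).
Project licence. -/
import Summits.QuantumFields.BalabanUV.T4Continuum.Spine.NE7b.KeyPatternReading

/-!
# THE PATTERN OF A TERM CLASS; run B's key pattern through the truncation and its reading; the (1.80)-shaped window
# ledger of a pinned key (regime (P) bookkeeping) — E-side suppliers of IR-104-2's road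

Crux-route work under `Spine/NE7b/` of the T⁴-continuum cell (rung (B)+1 on a FINITE torus only; NOT infinite volume, NOT the mass
gap, NOT Clay; NOT a proof of NE7b — `T4WeightBudget.RelWeightBound`, the cell's OWN estimate, NOT PRINTED, NOT PROVED).  [folklore]
finite combinatorics and `Finset` algebra over the TREE's own objects (IR-104-1 `…NE7b.KeyPatternReading`, gaps-ne6's pattern classes
`PrefixExtraction.admS` ∕ `PrefixExtractionLaws.histIdx ∕ badx`, the (α)-instance's tower family `B16HistoryReprChain.Tower` and
skeleton `B16HistoryReprInstance.skelFam ∕ hsmall`, the key fibres `T4LiveClassFibration.fibre`, print's (1.80) budget predicate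
`Balaban1983to89.Step.Budget.Controls`).  No `structure`, no `[cite:]` tag, no `def … : Prop`, nothing of Bałaban's, zero `sorry`.

WHY.  The OWNER's INTERFACE REQUEST NE7b IR-104-2 (ruling W-ne7bp1-g104-4, journal l.51421) re-cuts the END's record ONE STEP deeper:
the per-key extraction displays `extractA ∕ extractB` of `Support/B16HistoryTowerExtractionPricedDataLWR` are to be DERIVED from
per-(pinned step, pattern prefix) `PointwiseExtraction` + `LocCondStability` (`…NE7b.LocalConditionalStability`) along the KEY PATTERN,
by `PrefixExtractionLaws.extract_of_prefix_of_subset` ∘ `LocalConditionalStability.hrel_of_LCS`.  That theorem wants, per key, a READING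
of the key's sub-class into a pattern class.  For RUN A (the cutoff-`K` tower) IR-104-1 discharged it (`KeyPatternReading.fibre_kmemA_subset_badx`).
RUN B is the SAME family at cutoff `K + 1`, its terms read on run A's keys THROUGH the record's truncation `trunc K` (display `extractB`:
the sub-class is `{τ′ ∈ termSet (K+1) ∣ trunc K τ′ ∈ fibre … K k}`).  §1 types, ONCE, the pattern of an ARBITRARY class `Φ` of terms
of one cutoff (**`classPattern`**: the admissible next choices through which some history whose term lies in `Φ` passes) with its class
membership, its reading (`Φ ⊆` the pattern class, as soon as `Φ` consists of terms and misses the all-small term) and its minimality;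
§2 instantiates it for run B (**`filterB`**, **`keyPatternB`**, **`filterB_kmemA_subset_badx`** — the reading DISCHARGED at the step
reading under ONE normalisation of the truncation, «the all-small term truncates to the all-small term», display `htr0` of IR-104-2's
record).  §3 types the refuter's design clause τ-ne7bref-g63-1 (1) «book `(b − a)` per component over its persistence window,
(1.80)-shaped» AS A SUPPLIER LEMMA for regime (P): per-member budgets controlling every window above the birth level (print's (1.80),
`Step.Budget.Controls`, plus the component's removal past its horizon) and a birth extraction of at least budget + surplus give the
KEY-LEVEL window ledger `Σ_{n<K} (b n − a n) ≤ −Σ_q surplus q` that IR-104-2's record books (`ledgerA ∕ ledgerB`).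

WHAT.  §1 `classPattern`, `mem_classPattern`, `classPattern_subset_branch`, `mem_admS_classPattern`, **`subset_badx_classPattern`**,
`classPattern_subset_of_subset_badx` (minimality).  §2 (generic key map `kmem`, truncation `trunc`): `keyPattern_eq_classPattern` (IR-104-1's
`keyPattern` = `classPattern … (fibre …)` by `rfl`), `filterB` (= `extractB`'s index set), `keyPatternB := classPattern (K+1) (filterB K k)`,
**`filterB_subset_badx_keyPatternB`** (if the truncated all-small term's key is not `k`); at the step reading `𝒮.reading T p₀` with the key
family of record `kmemA`: **`filterB_kmemA_subset_badx`** under `hν0` + `htr0`, and `…_of_subset` along any pattern containing `keyPatternB`.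
§3 `window_sum_le_of_controls` ((1.80) + removal ⟹ every window above the
birth is controlled), **`ledger_of_budgets`** (`Σ_{n ∈ range K} (b n − a n) ≤ −Σ_{q ∈ Q} s q` for the booked live-cost ∕ birth-extraction
exponents of a finite member family born before `K`), **`ledger_of_controls`** (the same FROM print's (1.80) `Step.Budget.Controls` per member BY NAME).

HONEST.  Bookkeeping on OUR carriers; nothing of Bałaban's read anew, asserted, valued or discharged; the displays still OWE «LCS-j» per
pinned event (print's KIND, [Balaban1989LargeFieldII] (1.79)–(1.80) pp. 383–384 as LOCATORS only) and (A1c)'s identification; BY-NAME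
EFFECT ON THE WALL: NONE.  NE7b NOT PRINTED ∕ NOT PROVED; spine PROVED 0∕9.  HONEST DEPENDENCY (cell): continuum YM on T⁴ ⇐ BetaPertH ∧
nine spine estimates (0/9 proved); BetaPertH ⇐ (D1) ∧ (D4) ∧ CAP+tail; G-an2-4 gates asym, D1 and NE2/3/4.  This file changes none of it.
-/

open Finset
open Literature.MathematicalPhysics.QuantumFieldTheory.Balaban1983to89
open Literature.MathematicalPhysics.QuantumFieldTheory.Balaban1983to89.T4LiveClassFibration
open Literature.MathematicalPhysics.QuantumFieldTheory.Balaban1983to89.T4PersistenceDictionary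
open Literature.MathematicalPhysics.QuantumFieldTheory.Balaban1983to89.B13ScaleTransfer
open Summit.QuantumFields.BalabanUV.T4Continuum.B16HistoryReprChain
open Summit.QuantumFields.BalabanUV.T4Continuum.B16HistoryReprInstance
open Summit.QuantumFields.BalabanUV.T4Continuum.B16HistoryIndexedRepr
open Summit.QuantumFields.BalabanUV.T4Continuum.B16HistoryReprReadCausal
open Summit.QuantumFields.BalabanUV.T4Continuum.HistoryGenealogyInstantiate
open Summit.QuantumFields.BalabanUV.T4Continuum.HistoryAssemblyTerms
open Summit.QuantumFields.BalabanUV.T4Continuum.HistoryAssemblyPedigree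
open Summit.QuantumFields.BalabanUV.T4Continuum.HistoryAssemblyMult
open Summit.QuantumFields.BalabanUV.T4Continuum.HistoryAssemblyMultKey
open Summit.QuantumFields.BalabanUV.T4Continuum.HistoryRealiseCellsRunAssemblyWTVSData
open Summit.QuantumFields.BalabanUV.T4Continuum.NE7b.PrefixExtraction
open Summit.QuantumFields.BalabanUV.T4Continuum.NE7b.PrefixExtractionLaws
open Summit.QuantumFields.BalabanUV.T4Continuum.NE7b.KeyPatternReading

namespace Summit.QuantumFields.BalabanUV.T4Continuum.NE7b.KeyPatternReadingB

noncomputable section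

/-! ## §1 The pattern of an arbitrary class of terms of one cutoff -/

section ClassPattern

variable {P : Type} [DecidableEq P] {C : ℕ → ℕ → Type} {𝒢 : (K j : ℕ) → GoodClass (C K j)}
  (T : (K : ℕ) → Tower P (C K) (𝒢 K)) (p₀ : ℕ → ℕ → P)

open scoped Classical in
/-- **THE PATTERN OF THE TERM CLASS `Φ` AT CUTOFF `K`**: after the prefix `g` of `j` steps, the admissible next choices `p` THROUGH WHICH
SOME HISTORY WHOSE LARGE-SUMMAND TERM LIES IN `Φ` PASSES (`histIdx T p₀ K h ∈ Φ` and `h|_{j+1} = snoc g p`) — the projection of `Φ` onto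
step `j`.  IR-104-1's `keyPattern` is the case `Φ = fibre kmem … K k`; run B's (§2) the case `Φ = filterB … K k` at cutoff `K + 1`.  Data,
nothing asserted. [folklore] -/
def classPattern (K : ℕ) (Φ : Finset (HIndex.Idx (skelFam T p₀))) (j : ℕ) (g : Fin j → P) : Finset P :=
  ((T K).branch j g).filter fun p => ∃ (h : Fin K → P) (hj : j < K), histIdx T p₀ K h ∈ Φ ∧ Fin.take (j + 1) hj h = Fin.snoc g p

/-- membership in the class pattern. [folklore] -/
theorem mem_classPattern {K : ℕ} {Φ : Finset (HIndex.Idx (skelFam T p₀))} {j : ℕ} {g : Fin j → P} {p : P} :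
    p ∈ classPattern T p₀ K Φ j g ↔ p ∈ (T K).branch j g ∧
      ∃ (h : Fin K → P) (hj : j < K), histIdx T p₀ K h ∈ Φ ∧ Fin.take (j + 1) hj h = Fin.snoc g p := by
  classical
  exact Finset.mem_filter

/-- the class pattern consists of admissible next choices. [folklore] -/
theorem classPattern_subset_branch (K : ℕ) (Φ : Finset (HIndex.Idx (skelFam T p₀))) (j : ℕ) (g : Fin j → P) :
    classPattern T p₀ K Φ j g ⊆ (T K).branch j g :=
  fun _ hp => ((mem_classPattern T p₀).1 hp).1

/-- **AN ADMISSIBLE HISTORY WHOSE TERM LIES IN THE CLASS LIES IN THE CLASS PATTERN's PATTERN CLASS** (witnessed by itself). [folklore] -/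
theorem mem_admS_classPattern {K : ℕ} {Φ : Finset (HIndex.Idx (skelFam T p₀))} {h : Fin K → P} (hh : h ∈ (T K).adm K)
    (hΦ : histIdx T p₀ K h ∈ Φ) : h ∈ admS (T K) (classPattern T p₀ K Φ) K :=
  mem_admS_of_forall (T K) hh fun j => (mem_classPattern T p₀).2
    ⟨(T K).apply_mem_branch hh j, h, j.2, hΦ, Fin.take_succ_eq_snoc j j.2 h⟩

/-- **THE READING OF A TERM CLASS INTO ITS PATTERN's CLASS**: a class of TERMS of the cutoff-`K` skeleton MISSING THE ALL-SMALL TERM lies in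
the pinned class of its own pattern (every other term is the large-summand term of an admissible history, in the class by
`mem_admS_classPattern`).  The pinned class is written `badx T p₀ (fun _ S ↦ S) K (classPattern …)` — the pattern ITSELF as the key — so that
`PrefixExtractionLaws.extract_of_prefix_of_subset` applies verbatim. [folklore] -/
theorem subset_badx_classPattern {K : ℕ} {Φ : Finset (HIndex.Idx (skelFam T p₀))} (hΦ : Φ ⊆ HIndex.termSet (skelFam T p₀) K)
    (hsm : (⟨K, false, (hsmall (p₀ K) K, (), ())⟩ : HIndex.Idx (skelFam T p₀)) ∉ Φ) :
    Φ ⊆ badx T p₀ (fun _ (S : (j : ℕ) → (Fin j → P) → Finset P) => S) K (classPattern T p₀ K Φ) := by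
  intro τ hτ
  rcases mem_termSet_skelFam T p₀ (hΦ hτ) with ⟨h, hh, rfl⟩ | rfl
  · exact Finset.mem_map.2 ⟨h, mem_admS_classPattern T p₀ (Finset.mem_of_mem_erase hh) hτ, rfl⟩
  · exact absurd hτ hsm

/-- **MINIMALITY: THE CLASS PATTERN IS THE LEAST PREFIX PATTERN WHOSE CLASS READS `Φ`** — if `Φ ⊆ badx T p₀ S K x` then, after every prefix,
the class pattern's choices are pattern choices of `S K x` (so per-step displays along any such `S` imply those along `classPattern`,
`admS_mono` ∕ `badx_mono`). [folklore] -/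
theorem classPattern_subset_of_subset_badx {α : Type*} (S : (K : ℕ) → α → (j : ℕ) → (Fin j → P) → Finset P) {K : ℕ}
    {Φ : Finset (HIndex.Idx (skelFam T p₀))} {x : α} (hread : Φ ⊆ badx T p₀ S K x) (j : ℕ) (g : Fin j → P) :
    classPattern T p₀ K Φ j g ⊆ (T K).branch j g ∩ S K x j g := by
  intro p hp
  obtain ⟨hb, h, hj, hΦ, htake⟩ := (mem_classPattern T p₀).1 hp
  refine Finset.mem_inter.2 ⟨hb, ?_⟩
  obtain ⟨h', hh', he⟩ := Finset.mem_map.1 (hread hΦ)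
  obtain rfl : h' = h := histIdx_injective T p₀ K he
  have hs := forall_of_mem_admS (T K) hh' ⟨j, hj⟩
  rw [Fin.take_succ_eq_snoc] at htake
  have hg : Fin.take j (Nat.le_of_lt hj) h' = g := by
    simpa only [Fin.init_snoc] using congrArg Fin.init htake
  have hpj : h' ⟨j, hj⟩ = p := by
    simpa only [Fin.snoc_last] using congrFun htake (Fin.last j)
  rw [← hg, ← hpj]
  exact hs

/-- The class pattern is monotone in the class. [folklore] -/
theorem classPattern_mono {K : ℕ} {Φ Φ' : Finset (HIndex.Idx (skelFam T p₀))} (hΦ : Φ ⊆ Φ') (j : ℕ) (g : Fin j → P) :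
    classPattern T p₀ K Φ j g ⊆ classPattern T p₀ K Φ' j g := fun p hp => by
  obtain ⟨hb, h, hj, hm, ht⟩ := (mem_classPattern T p₀).1 hp
  exact (mem_classPattern T p₀).2 ⟨hb, h, hj, hΦ hm, ht⟩

end ClassPattern

/-! ## §2 Run B: the sub-class of a key through the truncation, its key pattern, and the reading at the step reading -/

section RunB

variable {P : Type} [DecidableEq P] {C : ℕ → ℕ → Type} {𝒢 : (K j : ℕ) → GoodClass (C K j)}
  (T : (K : ℕ) → Tower P (C K) (𝒢 K)) (p₀ : ℕ → ℕ → P) {ω : Type*} [DecidableEq ω]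
  (kmem : ℕ → HIndex.Idx (skelFam T p₀) → ω) (trunc : ℕ → HIndex.Idx (skelFam T p₀) → HIndex.Idx (skelFam T p₀))

/-- **IR-104-1's KEY PATTERN IS THE CLASS PATTERN OF THE KEY FIBRE**, definitionally (so `KeyPatternReading`'s §2 is §1's case
`Φ = fibre kmem … K k` BY NAME; leaf-02 g125 co-read ι-1). [folklore] -/
theorem keyPattern_eq_classPattern (K : ℕ) (k : ω) :
    keyPattern T p₀ kmem K k = classPattern T p₀ K (fibre kmem (HIndex.termSet (skelFam T p₀)) K k) := rfl

/-- **RUN B's SUB-CLASS OF THE KEY `k` OF RUN A AT CUTOFF `K`**: the terms of the cutoff-`(K+1)` skeleton truncating into the fibre of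
`k` — the index set of the display `extractB`.  Data, nothing asserted. [folklore] -/
def filterB (K : ℕ) (k : ω) : Finset (HIndex.Idx (skelFam T p₀)) :=
  (HIndex.termSet (skelFam T p₀) (K + 1)).filter fun τ' => trunc K τ' ∈ fibre kmem (HIndex.termSet (skelFam T p₀)) K k

/-- membership in run B's sub-class. [folklore] -/
theorem mem_filterB {K : ℕ} {k : ω} {τ' : HIndex.Idx (skelFam T p₀)} :
    τ' ∈ filterB T p₀ kmem trunc K k ↔
      τ' ∈ HIndex.termSet (skelFam T p₀) (K + 1) ∧ trunc K τ' ∈ fibre kmem (HIndex.termSet (skelFam T p₀)) K k :=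
  Finset.mem_filter

/-- run B's sub-class consists of terms of the cutoff-`(K+1)` skeleton. [folklore] -/
theorem filterB_subset_termSet (K : ℕ) (k : ω) : filterB T p₀ kmem trunc K k ⊆ HIndex.termSet (skelFam T p₀) (K + 1) :=
  Finset.filter_subset _ _

/-- **RUN B's KEY PATTERN OF THE KEY `k`**: the class pattern, at cutoff `K + 1`, of run B's sub-class of `k` — after the prefix `g` of
`j` steps, the admissible next choices of the cutoff-`(K+1)` tower through which some `(K+1)`-history truncating into the fibre of `k`
passes.  Data, nothing asserted. [folklore] -/
def keyPatternB (K : ℕ) (k : ω) : (j : ℕ) → (Fin j → P) → Finset P :=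
  classPattern T p₀ (K + 1) (filterB T p₀ kmem trunc K k)

/-- run B's key pattern consists of admissible next choices of the cutoff-`(K+1)` tower. [folklore] -/
theorem keyPatternB_subset_branch (K : ℕ) (k : ω) (j : ℕ) (g : Fin j → P) :
    keyPatternB T p₀ kmem trunc K k j g ⊆ (T (K + 1)).branch j g :=
  classPattern_subset_branch T p₀ (K + 1) _ j g

/-- **RUN B's SUB-CLASS OF `k` LIES IN RUN B's KEY PATTERN's PINNED CLASS** whenever the truncated all-small term's key is not `k`.
[folklore] -/
theorem filterB_subset_badx_keyPatternB (K : ℕ) (k : ω)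
    (hsk : kmem K (trunc K ⟨K + 1, false, (hsmall (p₀ (K + 1)) (K + 1), (), ())⟩) ≠ k) :
    filterB T p₀ kmem trunc K k ⊆
      badx T p₀ (fun _ (S : (j : ℕ) → (Fin j → P) → Finset P) => S) (K + 1) (keyPatternB T p₀ kmem trunc K k) :=
  subset_badx_classPattern T p₀ (filterB_subset_termSet T p₀ kmem trunc K k) fun hm =>
    hsk (mem_fibre.1 ((mem_filterB T p₀ kmem trunc).1 hm).2).2

variable {d : ℕ} (𝒮 : StepReading P d) (n L : ℕ) (hn : 0 < n) (hL : 0 < L)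

/-- **RUN B's READING AT THE STEP READING, DISCHARGED**: if the small-field choice names no region (`hν0`, IR-104-1's letter) and THE
ALL-SMALL TERM TRUNCATES TO THE ALL-SMALL TERM (`htr0`, IR-104-2's display on `trunc`), then for every bad key of record `k` of the window
run B's sub-class of `k` lies in run B's key pattern's pinned class (the truncated all-small term has the EMPTY key family, a bad key is
non-empty — `KeyPatternReading.kmemA_small_eq_empty` ∕ `kmemA_ne_empty_of_mem_badGMems`). [folklore] -/
theorem filterB_kmemA_subset_badx (trunc : ℕ → HIndex.Idx (skelFam T p₀) → HIndex.Idx (skelFam T p₀))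
    (hν0 : ∀ K j g, 𝒮.ν K j g (p₀ K j) = ∅)
    (htr0 : ∀ K, trunc K ⟨K + 1, false, (hsmall (p₀ (K + 1)) (K + 1), (), ())⟩ = ⟨K, false, (hsmall (p₀ K) K, (), ())⟩)
    {jstar : ℕ → ℕ} {K : ℕ} {k : Finset ((Fin d → ℕ) × Gen PEv × Multiset (PEv × ((Fin d → ℕ) × Finset (Pt d))))}
    (hk : k ∈ badGMems (memA n L (𝒮.reading T p₀)) jstar (HIndex.termSet (skelFam T p₀)) (kmemA n L hn hL (𝒮.reading T p₀)) K) :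
    filterB T p₀ (kmemA n L hn hL (𝒮.reading T p₀)) trunc K k ⊆
      badx T p₀ (fun _ (S : (j : ℕ) → (Fin j → P) → Finset P) => S) (K + 1)
        (keyPatternB T p₀ (kmemA n L hn hL (𝒮.reading T p₀)) trunc K k) :=
  filterB_subset_badx_keyPatternB T p₀ _ trunc K k (by
    rw [htr0 K, kmemA_small_eq_empty 𝒮 T p₀ n L hn hL hν0 K]
    exact (kmemA_ne_empty_of_mem_badGMems n L hn hL (𝒮.reading T p₀) hk).symm)

/-- **… ALONG ANY PATTERN OF THE CUTOFF-`(K+1)` TOWER CONTAINING RUN B's KEY PATTERN** (`badx_mono`). [folklore] -/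
theorem filterB_kmemA_subset_badx_of_subset (trunc : ℕ → HIndex.Idx (skelFam T p₀) → HIndex.Idx (skelFam T p₀))
    (hν0 : ∀ K j g, 𝒮.ν K j g (p₀ K j) = ∅)
    (htr0 : ∀ K, trunc K ⟨K + 1, false, (hsmall (p₀ (K + 1)) (K + 1), (), ())⟩ = ⟨K, false, (hsmall (p₀ K) K, (), ())⟩)
    {S : (j : ℕ) → (Fin j → P) → Finset P} {jstar : ℕ → ℕ} {K : ℕ}
    {k : Finset ((Fin d → ℕ) × Gen PEv × Multiset (PEv × ((Fin d → ℕ) × Finset (Pt d))))}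
    (hS : ∀ j g, keyPatternB T p₀ (kmemA n L hn hL (𝒮.reading T p₀)) trunc K k j g ⊆ S j g)
    (hk : k ∈ badGMems (memA n L (𝒮.reading T p₀)) jstar (HIndex.termSet (skelFam T p₀)) (kmemA n L hn hL (𝒮.reading T p₀)) K) :
    filterB T p₀ (kmemA n L hn hL (𝒮.reading T p₀)) trunc K k ⊆
      badx T p₀ (fun _ (S : (j : ℕ) → (Fin j → P) → Finset P) => S) (K + 1) S :=
  (filterB_kmemA_subset_badx T p₀ 𝒮 n L hn hL trunc hν0 htr0 hk).trans
    (badx_mono T p₀ (S := fun _ (S : (j : ℕ) → (Fin j → P) → Finset P) => S)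
      (S' := fun _ (_ : (j : ℕ) → (Fin j → P) → Finset P) => S) (K := K + 1) hS)

end RunB

/-! ## §3 The (1.80)-shaped window ledger of a pinned key (regime (P) bookkeeping; τ-ne7bref-g63-1 (1)) -/

section Ledger

open Literature.MathematicalPhysics.QuantumFieldTheory.Balaban1983to89.Step

/-- **(1.80) PLUS REMOVAL CONTROL EVERY WINDOW ABOVE THE BIRTH.**  If the budget `κ` controls the `Kh` steps after the birth level `j`
(print's (1.80): `Σ_{n ∈ Ioc j (j+Kh)} cost n (s n) ≤ κ`, `Step.Budget.Controls`), the costs are non-negative and the size profile vanishes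
past the horizon (the component is removed by the 𝐑-operation, p. 384: no live cost afterwards), then the live cost of EVERY window
`{n < K ∣ j < n}` is at most `κ`. [folklore] -/
theorem window_sum_le_of_controls (b : Budget.Consts) {j Kh : ℕ} {κ : ℝ} {s : ℕ → ℝ} (hctl : Budget.Controls b j Kh κ s)
    (hcost : ∀ n, 0 ≤ b.cost n (s n)) (hdead : ∀ n, j + Kh < n → s n = 0) (K : ℕ) :
    ∑ n ∈ (Finset.range K).filter (fun n => j < n), b.cost n (s n) ≤ κ := by
  classical
  have hsplit : ∑ n ∈ (Finset.range K).filter (fun n => j < n), b.cost n (s n) =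
      ∑ n ∈ ((Finset.range K).filter (fun n => j < n)).filter (fun n => n ≤ j + Kh), b.cost n (s n) := by
    rw [← Finset.sum_filter_add_sum_filter_not _ (fun n => n ≤ j + Kh)]
    have hz : ∑ n ∈ ((Finset.range K).filter (fun n => j < n)).filter (fun n => ¬ n ≤ j + Kh), b.cost n (s n) = 0 :=
      Finset.sum_eq_zero fun n hn => by
        have hn' : j + Kh < n := lt_of_not_ge (Finset.mem_filter.1 hn).2
        simp [Budget.Consts.cost, hdead n hn']
    rw [hz, add_zero]
  rw [hsplit]
  refine le_trans (Finset.sum_le_sum_of_subset_of_nonneg (fun n hn => ?_) fun n _ _ => hcost n) hctl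
  simp only [Finset.mem_filter, Finset.mem_range] at hn
  exact Finset.mem_Ioc.2 ⟨hn.1.2, hn.2⟩

variable {Q : Type*}

/-- **THE KEY-LEVEL WINDOW LEDGER FROM PER-MEMBER BUDGETS** (τ-ne7bref-g63-1 (1): «book `(b − a)` per component over its persistence
window, (1.80)-shaped — NEVER a per-step letter `b ≤ a`»).  Members `q ∈ Qs` of a pinned key, each with a birth level `jb q < K`, a
budget `κ q`, a birth surplus `s q` (print: `2p₀(g_{j(q)})`, p. 384 «the factor connected with Z in the form exp(−κ_j(Z) − 2p₀(g_{j(Z)}))»)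
and per-level live costs `c q n` whose every window above the birth is controlled by the budget (`window_sum_le_of_controls`); the booked
per-level exponents are the LIVE COST `b n = Σ_q [jb q < n] c q n` and the BIRTH EXTRACTION `a n = Σ_q [jb q = n] (κ q + s q)`.  Then
`Σ_{n<K} (b n − a n) ≤ −Σ_q s q` — at free steps `a n = 0 < b n` is allowed; only the window sum is booked. [folklore] -/
theorem ledger_of_budgets (Qs : Finset Q) (jb : Q → ℕ) (κ s : Q → ℝ) (c : Q → ℕ → ℝ) {K : ℕ} (hjb : ∀ q ∈ Qs, jb q < K)
    (hctl : ∀ q ∈ Qs, ∑ n ∈ (Finset.range K).filter (fun n => jb q < n), c q n ≤ κ q) :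
    ∑ n ∈ Finset.range K,
        ((∑ q ∈ Qs, if jb q < n then c q n else 0) - ∑ q ∈ Qs, if jb q = n then κ q + s q else 0) ≤
      -∑ q ∈ Qs, s q := by
  classical
  rw [Finset.sum_sub_distrib, Finset.sum_comm, Finset.sum_comm (s := Finset.range K)]
  have hb : ∀ q ∈ Qs, ∑ n ∈ Finset.range K, (if jb q < n then c q n else 0) ≤ κ q := fun q hq => by
    rw [← Finset.sum_filter]; exact hctl q hq
  have ha : ∀ q ∈ Qs, ∑ n ∈ Finset.range K, (if jb q = n then κ q + s q else 0) = κ q + s q := fun q hq => by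
    rw [Finset.sum_ite_eq]; exact if_pos (Finset.mem_range.2 (hjb q hq))
  rw [Finset.sum_congr rfl ha]
  have := Finset.sum_le_sum hb
  rw [Finset.sum_add_distrib]
  linarith

/-- **THE WINDOW LEDGER FROM PRINT's (1.80) BY NAME** (regime (P)): members `q ∈ Qs` born at `jb q < K`, each with a budget `κ q` that
CONTROLS its `Kh q` steps after the birth in the sense of (1.80) (`Step.Budget.Controls b (jb q) (Kh q) (κ q) (sz q)`), non-negative costs, the
size profile `sz q` vanishing past the horizon (removal), and a birth surplus `s q`; booked live cost `b n = Σ_q [jb q < n] cost n (sz q n)`,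
booked birth extraction `a n = Σ_q [jb q = n] (κ q + s q)`.  Then `Σ_{n<K} (b n − a n) ≤ −Σ_q s q` — `ledger_of_budgets` ∘
`window_sum_le_of_controls`. [folklore] -/
theorem ledger_of_controls (b : Budget.Consts) (Qs : Finset Q) (jb Kh : Q → ℕ) (κ s : Q → ℝ) (sz : Q → ℕ → ℝ) {K : ℕ}
    (hjb : ∀ q ∈ Qs, jb q < K) (hctl : ∀ q ∈ Qs, Budget.Controls b (jb q) (Kh q) (κ q) (sz q))
    (hcost : ∀ q ∈ Qs, ∀ n, 0 ≤ b.cost n (sz q n)) (hdead : ∀ q ∈ Qs, ∀ n, jb q + Kh q < n → sz q n = 0) :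
    ∑ n ∈ Finset.range K,
        ((∑ q ∈ Qs, if jb q < n then b.cost n (sz q n) else 0) - ∑ q ∈ Qs, if jb q = n then κ q + s q else 0) ≤
      -∑ q ∈ Qs, s q :=
  ledger_of_budgets Qs jb κ s (fun q n => b.cost n (sz q n)) hjb fun q hq =>
    window_sum_le_of_controls b (hctl q hq) (hcost q hq) (hdead q hq) K

end Ledger

end

end Summit.QuantumFields.BalabanUV.T4Continuum.NE7b.KeyPatternReadingB
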